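import Literature.Algebra.Polynomial.PolyaSzegoHalfLine
import Literature.Computability.QuantumComplexity.QuantumMarginals
import HarnessLib

/-!
# Polynomial matrix programs and their translation into SDPs — Simmons-Duffin 2015 (SDPB), §2.1–§2.2

Topic `Literature/Computation/Certificates` (joins `SemidefiniteRigorousBounds.lean`, `GramSOS.lean`,
`RealFormHermitianBlocks.lean`: the contracts behind semidefinite certificates). Source: D. Simmons-Duffin,
*A semidefinite program solver for the conformal bootstrap*, JHEP 06 (2015) 174, arXiv:1502.02033
[Simmonsduffin2015], §2.1 "Polynomial matrix programs" and §2.2 "Translating PMPs into SDPs", journal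
pp. 3–5 (held copies `paper:doi-10-1007-jhep06-2015-174` PDF pp. 4–6, `paper:arxiv-1502.02033`); equation
numbers are those of the published version. Every numerical conformal-bootstrap bound since 2015, and every
`pmp`-style positivity certificate a verifier re-checks in exact arithmetic, rests on the SOUNDNESS half of
this translation, which is what this file proves; nothing here is numerical.

**The PMP** [Simmonsduffin2015, §2.1 eq. (2.2)]: given symmetric polynomial matrices `M_j^n(x)`
(`0 ≤ n ≤ N`, `1 ≤ j ≤ J`, entries `P^n_{j,rs}(x)` real polynomials) and `b ∈ ℝ^N`,
"maximize `b·y` over `y ∈ ℝ^N` such that `M_j^0(x) + Σ_{n=1}^N y_n M_j^n(x) ⪰ 0` for all `x ≥ 0` and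
`1 ≤ j ≤ J`" (`constraintMatrix`, `ConstraintHolds`, `Feasible`, `IsOptimal`).

**Bilinear bases** [§2.2 eqs. (2.5)–(2.8)]: for polynomials `q_0, q_1, …` ("a bilinear basis") and
`Q_δ(x) = q⃗_δ(x) q⃗_δ(x)ᵀ`, a symmetric `m × m` polynomial matrix is written
"`M(x) = Tr_{ℝ^{δ₁+1}}(Y₁ (Q_{δ₁}(x) ⊗ 1_{m×m})) + x Tr_{ℝ^{δ₂+1}}(Y₂ (Q_{δ₂}(x) ⊗ 1_{m×m}))` … where now `Y₁`
acts on `ℝ^{δ₁+1} ⊗ ℝ^m` and `Y₂` similarly acts on `ℝ^{δ₂+1} ⊗ ℝ^m`, and each trace is over the first tensor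
factor" (2.8). Here the partial trace over the first factor of `κ × ι` is the tree's
`Literature.Computability.QuantumComplexity.traceLeft` (`QuantumMarginals.lean`; not re-declared),
`bilinearTerm q Y = Tr_κ(Y (q qᵀ ⊗ 1))` is a matrix over `ℝ[X]`, and
`pmpForm q₁ Y₁ q₂ Y₂ = bilinearTerm q₁ Y₁ + X • bilinearTerm q₂ Y₂` is (2.8). The basis index types
`κ₁, κ₂` are arbitrary finite types (the paper's `{0, …, δ}`; an EMPTY `κ₂` is the degree-0 case), the
block index `ι` is any finite type (the paper's `{1, …, m}`).

**Theorem 2.1** [§2.2]: "`M(x)` is positive semidefinite for `x ∈ ℝ⁺` if and only if it can be written in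
the form (2.8) for some positive semidefinite `Y₁` and `Y₂`." PROVED here:
* the direction the translation USES (⇐, "one direction is simple: choose a vector `v ∈ ℝ^m` and consider
  the pairing `vᵀ M(x) v = Tr(Y₁ (Q_{δ₁}(x) ⊗ vvᵀ)) + Tr(Y₂ (x Q_{δ₂}(x) ⊗ vvᵀ))` …") in full generality:
  `dotProduct_traceLeft_mulVec` (the pairing, as `wᵀ Y w` with `w = q⃗(x) ⊗ v`),
  `posSemidef_traceLeft_mul_kronecker` and **`posSemidef_eval_pmpForm`**;
* the converse (⇒, "less trivial … proven directly in [Hanselka, unpublished] and also … a consequence of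
  the Biform Theorem") for `m = 1` with the monomial basis, from the tree's Pólya–Szegő theorem
  `Literature.Algebra.Polynomial.polyaSzego_halfLine`: `exists_pmpForm_of_eval_nonneg`. The general-`m`
  converse is not used by the translation's soundness and is not restated as a named fact.

**Sampling** [§2.2 eqs. (2.10)–(2.11)]: "Equality between polynomials of degree `d_j` is equivalent to
equality at `d_j + 1` points. Thus, evaluating (2.10) at points `x_0, …, x_{d_j}`, we obtain a set of
affine relations between the `y_n` and `Y_j`" — `d_j = max_n deg M_j^n`, `δ_{j1} = ⌊d_j/2⌋`,
`δ_{j2} = ⌊(d_j−1)/2⌋`. PROVED: `natDegree_pmpForm_le` (the form (2.8) has entries of degree `≤ d` as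
soon as `2 deg q₁ ≤ d`, `2 deg q₂ + 1 ≤ d`), `constraintMatrix_eq_pmpForm_of_eval_eq` (agreement at
`d + 1` distinct points ⇒ the polynomial identity (2.10), by Lagrange uniqueness
`Polynomial.eq_of_degrees_lt_of_eval_finset_eq`) and the soundness statement a certificate reader relies
on, **`constraintHolds_of_sampled`**: PSD `Y₁, Y₂` satisfying the sampled equalities (2.11) witness the
PMP constraint (2.2) for that `j`. The paper isolates the entry `(r,s)` with the symmetrised unit matrix
`E^{rs}` (2.9) (`symUnit`): `trace_mul_kronecker_symUnit` (`Tr(Y (Q ⊗ E^{rs}))` = the average of the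
`(r,s)` and `(s,r)` entries of `Tr_κ(Y (Q ⊗ 1))`, for any `Y`, `Q`) and
`trace_mul_kronecker_symUnit_eq_eval` (for symmetric `Y` the number `Tr(Y (Q(x_k) ⊗ E^{rs}))` of (2.11)
IS `(bilinearTerm q Y r s)(x_k)`, the form used here).

Design: plain finite sums over `Fintype` index types, real coefficients, Mathlib's `Matrix.PosSemidef`,
`Matrix.kroneckerMap` (`⊗ₖ`) and `Polynomial`; no `Prop`-valued named facts — everything is proved.
-/

namespace Literature.Computation.Certificates

open Matrix Finset Polynomial
open Literature.Computability.QuantumComplexity (traceLeft traceLeft_apply)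
open scoped Kronecker Polynomial

namespace SimmonsDuffin2015

variable {ι κ κ₁ κ₂ R : Type*}

/-! ### Partial trace over the first tensor factor and the pairing identity -/

section PartialTrace

variable [Fintype κ] [Fintype ι] [DecidableEq ι] [CommSemiring R]

/-- `(Tr_κ (Y (Q ⊗ 1)))_{rs} = Σ_{a,b} Y_{(a,r),(b,s)} Q_{ba}`. [cite: Simmonsduffin2015, §2.2 eq. (2.8)] -/
theorem traceLeft_mul_kronecker_one_apply (Y : Matrix (κ × ι) (κ × ι) R) (Q : Matrix κ κ R)
    (r s : ι) : traceLeft (Y * Q ⊗ₖ (1 : Matrix ι ι R)) r s = ∑ a, ∑ b, Y (a, r) (b, s) * Q b a := by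
  simp only [traceLeft_apply, Matrix.mul_apply, Fintype.sum_prod_type, Matrix.kroneckerMap_apply,
    Matrix.one_apply, mul_ite, mul_one, mul_zero, Finset.sum_ite_eq', Finset.mem_univ, if_true]

/-- **The pairing of the proof of Theorem 2.1:** for `Q = u uᵀ`,
`vᵀ · Tr_κ(Y (u uᵀ ⊗ 1)) · v = wᵀ Y w` with `w = u ⊗ v` (`w_{(a,r)} = u_a v_r`) — the paper's
"`vᵀ M(x) v = Tr(Y (Q(x) ⊗ vvᵀ))`" written as a quadratic form in `Y`.
[cite: Simmonsduffin2015, §2.2 Theorem 2.1 (proof)] -/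
theorem dotProduct_traceLeft_mulVec (Y : Matrix (κ × ι) (κ × ι) R) (u : κ → R) (v : ι → R) :
    v ⬝ᵥ (traceLeft (Y * vecMulVec u u ⊗ₖ (1 : Matrix ι ι R)) *ᵥ v) =
      (fun p : κ × ι => u p.1 * v p.2) ⬝ᵥ (Y *ᵥ fun p : κ × ι => u p.1 * v p.2) := by
  let F : κ → ι → κ → ι → R := fun a r b s => u a * v r * (Y (a, r) (b, s) * (u b * v s))
  have hL : v ⬝ᵥ (traceLeft (Y * vecMulVec u u ⊗ₖ (1 : Matrix ι ι R)) *ᵥ v) =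
      ∑ r, ∑ s, ∑ a, ∑ b, F a r b s := by
    simp only [F, dotProduct, mulVec, traceLeft_mul_kronecker_one_apply, vecMulVec_apply,
      Finset.mul_sum, Finset.sum_mul]
    exact Finset.sum_congr rfl fun r _ => Finset.sum_congr rfl fun s _ =>
      Finset.sum_congr rfl fun a _ => Finset.sum_congr rfl fun b _ => by ring
  have hR : ((fun p : κ × ι => u p.1 * v p.2) ⬝ᵥ (Y *ᵥ fun p : κ × ι => u p.1 * v p.2)) =
      ∑ a, ∑ r, ∑ b, ∑ s, F a r b s := by
    simp only [F, dotProduct, mulVec, Fintype.sum_prod_type, Finset.mul_sum]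
  rw [hL, hR]
  calc ∑ r, ∑ s, ∑ a, ∑ b, F a r b s = ∑ r, ∑ a, ∑ b, ∑ s, F a r b s :=
        Finset.sum_congr rfl fun r _ =>
          Finset.sum_comm.trans (Finset.sum_congr rfl fun a _ => Finset.sum_comm)
    _ = ∑ a, ∑ r, ∑ b, ∑ s, F a r b s := Finset.sum_comm

end PartialTrace

/-! ### Positive semidefiniteness (Theorem 2.1, the direction the translation uses) -/

section Real

variable [Fintype κ] [Fintype ι] [DecidableEq ι]

/-- For `Y ⪰ 0` (real symmetric positive semidefinite on `ℝ^κ ⊗ ℝ^ι`) and any real vector `u`,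
`Tr_κ(Y (u uᵀ ⊗ 1)) ⪰ 0` — "since `Q(x) ⊗ vvᵀ` … [is] positive semidefinite, it follows that
`vᵀ M(x) v ≥ 0`". [cite: Simmonsduffin2015, §2.2 Theorem 2.1] -/
theorem posSemidef_traceLeft_mul_kronecker {Y : Matrix (κ × ι) (κ × ι) ℝ} (hY : Y.PosSemidef)
    (u : κ → ℝ) : (traceLeft (Y * vecMulVec u u ⊗ₖ (1 : Matrix ι ι ℝ))).PosSemidef := by
  refine PosSemidef.of_dotProduct_mulVec_nonneg (Matrix.IsHermitian.ext fun r s => ?_) fun v => ?_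
  · simp only [star_trivial, traceLeft_mul_kronecker_one_apply, vecMulVec_apply]
    rw [Finset.sum_comm]
    refine Finset.sum_congr rfl fun a _ => Finset.sum_congr rfl fun b _ => ?_
    have h := hY.1.apply (a, r) (b, s)
    rw [star_trivial] at h
    rw [← h, mul_comm (u a) (u b)]
  · rw [star_trivial, dotProduct_traceLeft_mulVec]
    simpa only [star_trivial] using hY.dotProduct_mulVec_nonneg fun p : κ × ι => u p.1 * v p.2

end Real

/-! ### The bilinear-basis form (2.8) as a polynomial matrix -/

section Form

variable [Fintype κ] [Fintype κ₁] [Fintype κ₂] [Fintype ι] [DecidableEq ι]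

/-- One term of (2.8): the polynomial matrix `Tr_κ(Y (Q(x) ⊗ 1_{m×m}))`, `Q(x) = q⃗(x) q⃗(x)ᵀ`, for a
bilinear basis `q⃗ = (q_a)_{a ∈ κ}` of real polynomials and a real matrix `Y` on `ℝ^κ ⊗ ℝ^ι`.
[cite: Simmonsduffin2015, §2.2 eqs. (2.6), (2.8)] -/
noncomputable def bilinearTerm (q : κ → ℝ[X]) (Y : Matrix (κ × ι) (κ × ι) ℝ) : Matrix ι ι ℝ[X] :=
  traceLeft (Y.map (C : ℝ → ℝ[X]) * vecMulVec q q ⊗ₖ (1 : Matrix ι ι ℝ[X]))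

/-- Entries of (2.8)'s term: `(Tr_κ(Y (Q ⊗ 1)))_{rs} = Σ_{a,b} Y_{(a,r),(b,s)} q_b q_a`.
[cite: Simmonsduffin2015, §2.2 eq. (2.8)] -/
theorem bilinearTerm_apply (q : κ → ℝ[X]) (Y : Matrix (κ × ι) (κ × ι) ℝ) (r s : ι) :
    bilinearTerm q Y r s = ∑ a, ∑ b, C (Y (a, r) (b, s)) * (q b * q a) := by
  simp only [bilinearTerm, traceLeft_mul_kronecker_one_apply, Matrix.map_apply, vecMulVec_apply]

/-- Entries of (2.8)'s term evaluated at `x`: `Σ_{a,b} Y_{(a,r),(b,s)} q_b(x) q_a(x)` — for symmetric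
`Y` this is the number `Tr(Y (Q(x) ⊗ E^{rs}))` of (2.10)–(2.11). [cite: Simmonsduffin2015, §2.2 eq. (2.11)] -/
theorem bilinearTerm_apply_eval (q : κ → ℝ[X]) (Y : Matrix (κ × ι) (κ × ι) ℝ) (r s : ι) (x : ℝ) :
    (bilinearTerm q Y r s).eval x = ∑ a, ∑ b, Y (a, r) (b, s) * ((q b).eval x * (q a).eval x) := by
  simp only [bilinearTerm_apply, eval_finsetSum, eval_mul, eval_C]

/-- Evaluating the polynomial matrix `Tr_κ(Y (Q ⊗ 1))` at `x` gives the real matrix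
`Tr_κ(Y (Q(x) ⊗ 1))` with `Q(x) = q⃗(x) q⃗(x)ᵀ`. [cite: Simmonsduffin2015, §2.2 eq. (2.8)] -/
theorem bilinearTerm_map_eval (q : κ → ℝ[X]) (Y : Matrix (κ × ι) (κ × ι) ℝ) (x : ℝ) :
    (bilinearTerm q Y).map (eval x) =
      traceLeft (Y * vecMulVec (fun a => (q a).eval x) (fun a => (q a).eval x) ⊗ₖ
        (1 : Matrix ι ι ℝ)) := by
  ext r s
  simp only [Matrix.map_apply, bilinearTerm_apply_eval, traceLeft_mul_kronecker_one_apply,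
    vecMulVec_apply]

/-- **The bilinear-basis form (2.8)** of a symmetric polynomial matrix:
`Tr_{κ₁}(Y₁ (Q₁(x) ⊗ 1)) + x · Tr_{κ₂}(Y₂ (Q₂(x) ⊗ 1))`, `Q_i = q⃗_i q⃗_iᵀ`, as a matrix over `ℝ[X]`.
[cite: Simmonsduffin2015, §2.2 eq. (2.8)] -/
noncomputable def pmpForm (q₁ : κ₁ → ℝ[X]) (Y₁ : Matrix (κ₁ × ι) (κ₁ × ι) ℝ) (q₂ : κ₂ → ℝ[X])
    (Y₂ : Matrix (κ₂ × ι) (κ₂ × ι) ℝ) : Matrix ι ι ℝ[X] :=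
  bilinearTerm q₁ Y₁ + (X : ℝ[X]) • bilinearTerm q₂ Y₂

/-- Entries of (2.8) evaluated at `x` — the right-hand side of the sampled equality (2.11).
[cite: Simmonsduffin2015, §2.2 eqs. (2.8), (2.10)–(2.11)] -/
theorem pmpForm_apply_eval (q₁ : κ₁ → ℝ[X]) (Y₁ : Matrix (κ₁ × ι) (κ₁ × ι) ℝ) (q₂ : κ₂ → ℝ[X])
    (Y₂ : Matrix (κ₂ × ι) (κ₂ × ι) ℝ) (r s : ι) (x : ℝ) :
    (pmpForm q₁ Y₁ q₂ Y₂ r s).eval x =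
      (bilinearTerm q₁ Y₁ r s).eval x + x * (bilinearTerm q₂ Y₂ r s).eval x := by
  simp only [pmpForm, Matrix.add_apply, Matrix.smul_apply, smul_eq_mul, eval_add, eval_mul, eval_X]

/-- Evaluating (2.8) at `x`: `M(x) = Tr_{κ₁}(Y₁ (Q₁(x) ⊗ 1)) + x • Tr_{κ₂}(Y₂ (Q₂(x) ⊗ 1))`.
[cite: Simmonsduffin2015, §2.2 eq. (2.8)] -/
theorem pmpForm_map_eval (q₁ : κ₁ → ℝ[X]) (Y₁ : Matrix (κ₁ × ι) (κ₁ × ι) ℝ) (q₂ : κ₂ → ℝ[X])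
    (Y₂ : Matrix (κ₂ × ι) (κ₂ × ι) ℝ) (x : ℝ) :
    (pmpForm q₁ Y₁ q₂ Y₂).map (eval x) =
      (bilinearTerm q₁ Y₁).map (eval x) + x • (bilinearTerm q₂ Y₂).map (eval x) := by
  ext r s
  simp only [Matrix.map_apply, pmpForm_apply_eval, Matrix.add_apply, Matrix.smul_apply, smul_eq_mul]

/-- **Theorem 2.1 (⇐), [Simmonsduffin2015, §2.2]:** if `Y₁ ⪰ 0` and `Y₂ ⪰ 0` then the polynomial matrix
(2.8) is positive semidefinite at every `x ≥ 0`. This is the direction on which the PMP → SDP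
translation (and every certificate in that format) relies. [cite: Simmonsduffin2015, §2.2 Theorem 2.1] -/
theorem posSemidef_eval_pmpForm (q₁ : κ₁ → ℝ[X]) {Y₁ : Matrix (κ₁ × ι) (κ₁ × ι) ℝ} (q₂ : κ₂ → ℝ[X])
    {Y₂ : Matrix (κ₂ × ι) (κ₂ × ι) ℝ} (hY₁ : Y₁.PosSemidef) (hY₂ : Y₂.PosSemidef) {x : ℝ}
    (hx : 0 ≤ x) : ((pmpForm q₁ Y₁ q₂ Y₂).map (eval x)).PosSemidef := by
  rw [pmpForm_map_eval, bilinearTerm_map_eval, bilinearTerm_map_eval]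
  exact (posSemidef_traceLeft_mul_kronecker hY₁ _).add
    ((posSemidef_traceLeft_mul_kronecker hY₂ _).smul hx)

/-! ### Degrees: the form (2.8) with `2 deg q₁ ≤ d`, `2 deg q₂ + 1 ≤ d` has entries of degree `≤ d` -/

/-- `deg (Tr_κ(Y (Q ⊗ 1)))_{rs} ≤ d` when `2 deg q_a ≤ d` for all `a` (`δ₁ = ⌊d/2⌋` in the paper).
[cite: Simmonsduffin2015, §2.2 eq. (2.6)] -/
theorem natDegree_bilinearTerm_le {q : κ → ℝ[X]} {d : ℕ} (hq : ∀ a, 2 * (q a).natDegree ≤ d)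
    (Y : Matrix (κ × ι) (κ × ι) ℝ) (r s : ι) : (bilinearTerm q Y r s).natDegree ≤ d := by
  rw [bilinearTerm_apply]
  refine natDegree_sum_le_of_forall_le _ _ fun a _ => natDegree_sum_le_of_forall_le _ _ fun b _ => ?_
  refine (natDegree_C_mul_le _ _).trans (natDegree_mul_le.trans ?_)
  have ha := hq a; have hb := hq b; omega

/-- `deg (x · Tr_κ(Y (Q ⊗ 1)))_{rs} ≤ d` when `2 deg q_a + 1 ≤ d` for all `a` (`δ₂ = ⌊(d−1)/2⌋`).
[cite: Simmonsduffin2015, §2.2 eq. (2.6)] -/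
theorem natDegree_X_mul_bilinearTerm_le {q : κ → ℝ[X]} {d : ℕ} (hq : ∀ a, 2 * (q a).natDegree + 1 ≤ d)
    (Y : Matrix (κ × ι) (κ × ι) ℝ) (r s : ι) : (X * bilinearTerm q Y r s).natDegree ≤ d := by
  rw [bilinearTerm_apply, Finset.mul_sum]
  refine natDegree_sum_le_of_forall_le _ _ fun a _ => ?_
  rw [Finset.mul_sum]
  refine natDegree_sum_le_of_forall_le _ _ fun b _ => ?_
  refine natDegree_mul_le.trans ?_
  have h1 : (X : ℝ[X]).natDegree ≤ 1 := natDegree_X_le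
  have h2 := (natDegree_C_mul_le (Y (a, r) (b, s)) (q b * q a)).trans natDegree_mul_le
  have ha := hq a; have hb := hq b; omega

/-- Entries of the form (2.8) have degree `≤ d` when `2 deg q₁ ≤ d` and `2 deg q₂ + 1 ≤ d`
(the paper's `δ₁ = ⌊d/2⌋`, `δ₂ = ⌊(d−1)/2⌋`). [cite: Simmonsduffin2015, §2.2 eqs. (2.6), (2.10)] -/
theorem natDegree_pmpForm_le {q₁ : κ₁ → ℝ[X]} {q₂ : κ₂ → ℝ[X]} {d : ℕ}
    (hq₁ : ∀ a, 2 * (q₁ a).natDegree ≤ d) (hq₂ : ∀ a, 2 * (q₂ a).natDegree + 1 ≤ d)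
    (Y₁ : Matrix (κ₁ × ι) (κ₁ × ι) ℝ) (Y₂ : Matrix (κ₂ × ι) (κ₂ × ι) ℝ) (r s : ι) :
    (pmpForm q₁ Y₁ q₂ Y₂ r s).natDegree ≤ d := by
  rw [pmpForm, Matrix.add_apply, Matrix.smul_apply, smul_eq_mul]
  exact natDegree_add_le_of_degree_le (natDegree_bilinearTerm_le hq₁ Y₁ r s)
    (natDegree_X_mul_bilinearTerm_le hq₂ Y₂ r s)

end Form

/-! ### The symmetrised unit matrices `E^{rs}` of (2.9)–(2.11) -/

section SymUnit

variable [DecidableEq ι]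

/-- The symmetrised unit matrix `(E^{rs})_{ij} = ½ (δ^r_i δ^s_j + δ^s_i δ^r_j)`, used to isolate the entry
`(r,s)` of a symmetric matrix by a trace. [cite: Simmonsduffin2015, §2.2 eq. (2.9)] -/
noncomputable def symUnit (r s : ι) : Matrix ι ι ℝ :=
  Matrix.of fun i j =>
    (if j = s then (if i = r then (1 / 2 : ℝ) else 0) else 0) +
      (if j = r then (if i = s then (1 / 2 : ℝ) else 0) else 0)

/-- Entries of `E^{rs}` (definition unfolding). [cite: Simmonsduffin2015, §2.2 eq. (2.9)] -/
theorem symUnit_apply (r s i j : ι) : symUnit r s i j =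
    (if j = s then (if i = r then (1 / 2 : ℝ) else 0) else 0) +
      (if j = r then (if i = s then (1 / 2 : ℝ) else 0) else 0) := rfl

variable [Fintype κ] [Fintype ι]

/-- `Tr(Y (Q ⊗ E^{rs}))` is the average of the `(r,s)` and `(s,r)` entries of `Tr_κ(Y (Q ⊗ 1))`, for ANY
real `Y`, `Q` (no symmetry needed). [cite: Simmonsduffin2015, §2.2 eqs. (2.8)–(2.11)] -/
theorem trace_mul_kronecker_symUnit (Y : Matrix (κ × ι) (κ × ι) ℝ) (Q : Matrix κ κ ℝ) (r s : ι) :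
    trace (Y * Q ⊗ₖ symUnit r s) =
      (1 / 2 : ℝ) * traceLeft (Y * Q ⊗ₖ (1 : Matrix ι ι ℝ)) r s +
        (1 / 2 : ℝ) * traceLeft (Y * Q ⊗ₖ (1 : Matrix ι ι ℝ)) s r := by
  simp only [Matrix.trace, Matrix.diag, Matrix.mul_apply, Fintype.sum_prod_type,
    Matrix.kroneckerMap_apply, symUnit_apply, traceLeft_mul_kronecker_one_apply, mul_add,
    Finset.sum_add_distrib, mul_ite, mul_zero, Finset.sum_ite_irrel, Finset.sum_ite_eq',
    Finset.mem_univ, if_true, Finset.sum_const_zero, Finset.mul_sum]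
  conv_lhs => rw [add_comm]
  congr 1 <;> exact Finset.sum_congr rfl fun a _ => Finset.sum_congr rfl fun b _ => by ring

/-- For symmetric `Y` (on `ℝ^κ ⊗ ℝ^ι`) and symmetric `Q`, the matrix `Tr_κ(Y (Q ⊗ 1))` is symmetric.
[cite: Simmonsduffin2015, §2.2 eq. (2.8)] -/
theorem traceLeft_mul_kronecker_symm_apply {Y : Matrix (κ × ι) (κ × ι) ℝ} (hY : Y.IsHermitian)
    {Q : Matrix κ κ ℝ} (hQ : Q.IsSymm) (r s : ι) :
    traceLeft (Y * Q ⊗ₖ (1 : Matrix ι ι ℝ)) s r = traceLeft (Y * Q ⊗ₖ (1 : Matrix ι ι ℝ)) r s := by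
  simp only [traceLeft_mul_kronecker_one_apply]
  rw [Finset.sum_comm]
  refine Finset.sum_congr rfl fun a _ => Finset.sum_congr rfl fun b _ => ?_
  have h := hY.apply (b, s) (a, r)
  rw [star_trivial] at h
  rw [← h, ← hQ.apply a b]

/-- **The right-hand side of (2.11):** for symmetric `Y`, `Tr(Y (Q(x) ⊗ E^{rs}))` with
`Q(x) = q⃗(x) q⃗(x)ᵀ` is the `(r,s)` entry of the form `Tr_κ(Y (Q ⊗ 1))` evaluated at `x`.
[cite: Simmonsduffin2015, §2.2 eq. (2.11)] -/
theorem trace_mul_kronecker_symUnit_eq_eval (q : κ → ℝ[X]) {Y : Matrix (κ × ι) (κ × ι) ℝ}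
    (hY : Y.IsHermitian) (r s : ι) (x : ℝ) :
    trace (Y * vecMulVec (fun a => (q a).eval x) (fun a => (q a).eval x) ⊗ₖ symUnit r s) =
      (bilinearTerm q Y r s).eval x := by
  have hQ : (vecMulVec (fun a => (q a).eval x) (fun a => (q a).eval x)).IsSymm :=
    Matrix.IsSymm.ext fun a b => by simp only [vecMulVec_apply, mul_comm]
  have h := congrFun (congrFun (bilinearTerm_map_eval q Y x) r) s
  rw [Matrix.map_apply] at h
  rw [trace_mul_kronecker_symUnit, traceLeft_mul_kronecker_symm_apply hY hQ r s, h]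
  ring

end SymUnit

/-! ### The PMP (2.2) and the soundness of the sampled translation (2.10)–(2.11) -/

section PMP

variable {N : ℕ}

/-- The polynomial matrix `M⁰(x) + Σ_{n=1}^N y_n Mⁿ(x)` of one PMP constraint.
[cite: Simmonsduffin2015, §2.1 eq. (2.2)] -/
noncomputable def constraintMatrix (M₀ : Matrix ι ι ℝ[X]) (M : Fin N → Matrix ι ι ℝ[X])
    (y : Fin N → ℝ) : Matrix ι ι ℝ[X] :=
  M₀ + ∑ n, y n • M n

/-- Entry `(r,s)` of `M⁰ + Σ y_n Mⁿ` at `x`: `P⁰_{rs}(x) + Σ_n y_n Pⁿ_{rs}(x)` — the left-hand side of (2.10)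
/ (2.11). [cite: Simmonsduffin2015, §2.2 eq. (2.11)] -/
theorem constraintMatrix_apply_eval (M₀ : Matrix ι ι ℝ[X]) (M : Fin N → Matrix ι ι ℝ[X])
    (y : Fin N → ℝ) (r s : ι) (x : ℝ) :
    (constraintMatrix M₀ M y r s).eval x = (M₀ r s).eval x + ∑ n, y n * (M n r s).eval x := by
  simp only [constraintMatrix, Matrix.add_apply, Matrix.sum_apply, Matrix.smul_apply, eval_add,
    eval_finsetSum, eval_smul, smul_eq_mul]

/-- Degree of the entries of `M⁰ + Σ y_n Mⁿ` (`d_j = max_n deg M_j^n` in (2.10)).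
[cite: Simmonsduffin2015, §2.2 eq. (2.10)] -/
theorem natDegree_constraintMatrix_le {M₀ : Matrix ι ι ℝ[X]} {M : Fin N → Matrix ι ι ℝ[X]} {d : ℕ}
    (hM₀ : ∀ r s, (M₀ r s).natDegree ≤ d) (hM : ∀ n r s, (M n r s).natDegree ≤ d) (y : Fin N → ℝ)
    (r s : ι) : (constraintMatrix M₀ M y r s).natDegree ≤ d := by
  rw [constraintMatrix, Matrix.add_apply, Matrix.sum_apply]
  refine natDegree_add_le_of_degree_le (hM₀ r s) (natDegree_sum_le_of_forall_le _ _ fun n _ => ?_)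
  rw [Matrix.smul_apply]
  exact (natDegree_smul_le _ _).trans (hM n r s)

variable [Fintype ι]

/-- **One PMP constraint** [Simmonsduffin2015, §2.1 eq. (2.2)]: `M⁰(x) + Σ_n y_n Mⁿ(x) ⪰ 0` for all
`x ≥ 0`. [cite: Simmonsduffin2015, §2.1 eq. (2.2)] -/
def ConstraintHolds (M₀ : Matrix ι ι ℝ[X]) (M : Fin N → Matrix ι ι ℝ[X]) (y : Fin N → ℝ) : Prop :=
  ∀ x : ℝ, 0 ≤ x → ((constraintMatrix M₀ M y).map (eval x)).PosSemidef

/-- **Feasibility of a PMP** with blocks `j ∈ J` of sizes `m_j` (block index types `blk j`):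
every constraint `j` holds. [cite: Simmonsduffin2015, §2.1 eq. (2.2)] -/
def Feasible {J : Type*} {blk : J → Type*} [∀ j, Fintype (blk j)]
    (M₀ : (j : J) → Matrix (blk j) (blk j) ℝ[X]) (M : (j : J) → Fin N → Matrix (blk j) (blk j) ℝ[X])
    (y : Fin N → ℝ) : Prop :=
  ∀ j, ConstraintHolds (M₀ j) (M j) y

/-- **The PMP** [Simmonsduffin2015, §2.1 eq. (2.2)]: `y` maximises `b · y` over the feasible set.
[cite: Simmonsduffin2015, §2.1 eq. (2.2)] -/
def IsOptimal {J : Type*} {blk : J → Type*} [∀ j, Fintype (blk j)] (b : Fin N → ℝ)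
    (M₀ : (j : J) → Matrix (blk j) (blk j) ℝ[X]) (M : (j : J) → Fin N → Matrix (blk j) (blk j) ℝ[X])
    (y : Fin N → ℝ) : Prop :=
  Feasible M₀ M y ∧ ∀ y', Feasible M₀ M y' → b ⬝ᵥ y' ≤ b ⬝ᵥ y

/-- "Equality between polynomials of degree `d` is equivalent to equality at `d + 1` points":
two real polynomials of degree `≤ d` agreeing at `d + 1` distinct points are equal (Lagrange).
[cite: Simmonsduffin2015, §2.2 eqs. (2.10)–(2.11)] -/
theorem eq_of_eval_eq_of_natDegree_le {P R : ℝ[X]} {d : ℕ} (hP : P.natDegree ≤ d) (hR : R.natDegree ≤ d)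
    (xs : Fin (d + 1) → ℝ) (hxs : Function.Injective xs) (h : ∀ k, P.eval (xs k) = R.eval (xs k)) :
    P = R := by
  classical
  have hcard : (Finset.univ.image xs).card = d + 1 := by
    rw [Finset.card_image_of_injective _ hxs, Finset.card_univ, Fintype.card_fin]
  have hlt : ∀ {S : ℝ[X]}, S.natDegree ≤ d → S.degree < ((Finset.univ.image xs).card : WithBot ℕ) :=
    fun hS => (degree_le_of_natDegree_le hS).trans_lt (by rw [hcard]; exact_mod_cast Nat.lt_succ_self d)
  refine eq_of_degrees_lt_of_eval_finset_eq _ (hlt hP) (hlt hR) fun x hx => ?_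
  obtain ⟨k, -, rfl⟩ := Finset.mem_image.mp hx
  exact h k

variable [DecidableEq ι] [Fintype κ₁] [Fintype κ₂]

/-- **(2.11) ⇒ (2.10):** if the entries of `M⁰ + Σ y_n Mⁿ` (degree `≤ d`) agree with those of the
bilinear-basis form (2.8) (`2 deg q₁ ≤ d`, `2 deg q₂ + 1 ≤ d`) at `d + 1` distinct sample points, the two
polynomial matrices are equal. [cite: Simmonsduffin2015, §2.2 eqs. (2.8), (2.10)–(2.11)] -/
theorem constraintMatrix_eq_pmpForm_of_eval_eq {M₀ : Matrix ι ι ℝ[X]} {M : Fin N → Matrix ι ι ℝ[X]}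
    {y : Fin N → ℝ} {d : ℕ} (hM₀ : ∀ r s, (M₀ r s).natDegree ≤ d) (hM : ∀ n r s, (M n r s).natDegree ≤ d)
    {q₁ : κ₁ → ℝ[X]} {q₂ : κ₂ → ℝ[X]} (hq₁ : ∀ a, 2 * (q₁ a).natDegree ≤ d)
    (hq₂ : ∀ a, 2 * (q₂ a).natDegree + 1 ≤ d) (Y₁ : Matrix (κ₁ × ι) (κ₁ × ι) ℝ)
    (Y₂ : Matrix (κ₂ × ι) (κ₂ × ι) ℝ) (xs : Fin (d + 1) → ℝ) (hxs : Function.Injective xs)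
    (hsample : ∀ k r s,
      (constraintMatrix M₀ M y r s).eval (xs k) = (pmpForm q₁ Y₁ q₂ Y₂ r s).eval (xs k)) :
    constraintMatrix M₀ M y = pmpForm q₁ Y₁ q₂ Y₂ := by
  refine Matrix.ext fun r s => ?_
  exact eq_of_eval_eq_of_natDegree_le (natDegree_constraintMatrix_le hM₀ hM y r s)
    (natDegree_pmpForm_le hq₁ hq₂ Y₁ Y₂ r s) xs hxs fun k => hsample k r s

/-- **Soundness of the PMP → SDP translation** [Simmonsduffin2015, §2.2]: positive semidefinite
`Y₁, Y₂` (the blocks `Y_{2j−1}, Y_{2j}` of (2.12)) satisfying the sampled affine relations (2.11) at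
`d + 1` distinct points — with bilinear bases of degrees `2 deg q₁ ≤ d`, `2 deg q₂ + 1 ≤ d`,
`d ≥ max_n deg Mⁿ` — witness the PMP constraint (2.2): `M⁰(x) + Σ_n y_n Mⁿ(x) ⪰ 0` for every `x ≥ 0`.
[cite: Simmonsduffin2015, §2.2 Theorem 2.1, eqs. (2.10)–(2.11)] -/
theorem constraintHolds_of_sampled {M₀ : Matrix ι ι ℝ[X]} {M : Fin N → Matrix ι ι ℝ[X]}
    {y : Fin N → ℝ} {d : ℕ} (hM₀ : ∀ r s, (M₀ r s).natDegree ≤ d) (hM : ∀ n r s, (M n r s).natDegree ≤ d)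
    {q₁ : κ₁ → ℝ[X]} {q₂ : κ₂ → ℝ[X]} (hq₁ : ∀ a, 2 * (q₁ a).natDegree ≤ d)
    (hq₂ : ∀ a, 2 * (q₂ a).natDegree + 1 ≤ d) {Y₁ : Matrix (κ₁ × ι) (κ₁ × ι) ℝ}
    {Y₂ : Matrix (κ₂ × ι) (κ₂ × ι) ℝ} (hY₁ : Y₁.PosSemidef) (hY₂ : Y₂.PosSemidef)
    (xs : Fin (d + 1) → ℝ) (hxs : Function.Injective xs)
    (hsample : ∀ k r s,
      (constraintMatrix M₀ M y r s).eval (xs k) = (pmpForm q₁ Y₁ q₂ Y₂ r s).eval (xs k)) :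
    ConstraintHolds M₀ M y := by
  intro x hx
  rw [constraintMatrix_eq_pmpForm_of_eval_eq hM₀ hM hq₁ hq₂ Y₁ Y₂ xs hxs hsample]
  exact posSemidef_eval_pmpForm q₁ q₂ hY₁ hY₂ hx

end PMP

/-! ### Theorem 2.1 (⇒) for `1 × 1` blocks, from Pólya–Szegő -/

section Converse

/-- **Theorem 2.1 (⇒) for `m = 1`** with the monomial bilinear basis `q_a = x^a` (`0 ≤ a ≤ S`): a real
polynomial `P` of degree `≤ 2S + 1` with `P ≥ 0` on `[0, ∞)` IS of the form (2.8),
`P = Tr(Y₁ Q_S(x)) + x Tr(Y₂ Q_S(x))` with `Y₁, Y₂ ⪰ 0` — from `polyaSzego_halfLine`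
(`P = Σ fᵢ² + x Σ gᵢ²`, `deg fᵢ, deg gᵢ ≤ S`) with the Gram matrices of the coefficient vectors.
[cite: Simmonsduffin2015, §2.2 Theorem 2.1] -/
theorem exists_pmpForm_of_eval_nonneg (S : ℕ) (P : ℝ[X]) (hdeg : P.natDegree ≤ 2 * S + 1)
    (hpos : ∀ x : ℝ, 0 ≤ x → 0 ≤ P.eval x) :
    ∃ Y₁ Y₂ : Matrix (Fin (S + 1) × Unit) (Fin (S + 1) × Unit) ℝ, Y₁.PosSemidef ∧ Y₂.PosSemidef ∧
      Matrix.of (fun _ _ : Unit => P) =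
        pmpForm (fun a : Fin (S + 1) => X ^ (a : ℕ)) Y₁ (fun a : Fin (S + 1) => X ^ (a : ℕ)) Y₂ := by
  obtain ⟨m, f, g, hfg, hP⟩ := Literature.Algebra.Polynomial.polyaSzego_halfLine S P hdeg hpos
  -- a polynomial of degree `≤ S` squared, in the monomial bilinear basis
  have hsq : ∀ p : ℝ[X], p.natDegree ≤ S → p ^ 2 =
      ∑ a : Fin (S + 1), ∑ b : Fin (S + 1),
        C (p.coeff a) * C (p.coeff b) * (X ^ (b : ℕ) * X ^ (a : ℕ)) := by
    intro p hp
    have hexp : p = ∑ a : Fin (S + 1), C (p.coeff a) * X ^ (a : ℕ) := by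
      rw [Fin.sum_univ_eq_sum_range (fun a => C (p.coeff a) * X ^ a) (S + 1)]
      exact as_sum_range_C_mul_X_pow' _ (Nat.lt_succ_of_le hp)
    conv_lhs => rw [hexp]
    rw [sq, Finset.sum_mul_sum]
    exact Finset.sum_congr rfl fun a _ => Finset.sum_congr rfl fun b _ => by ring
  -- Gram matrices of the coefficient vectors: `Y = Bᵀ B`, `B_{i,(a,·)} = coeff (h i) a`
  let B : (ℕ → ℝ[X]) → Matrix (Fin m) (Fin (S + 1) × Unit) ℝ :=
    fun h => Matrix.of fun i p => (h i).coeff p.1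
  have hGram : ∀ h : ℕ → ℝ[X], (∀ i < m, (h i).natDegree ≤ S) →
      bilinearTerm (fun a : Fin (S + 1) => X ^ (a : ℕ)) ((B h)ᴴ * B h) () () =
        ∑ i ∈ Finset.range m, h i ^ 2 := by
    intro h hh
    rw [bilinearTerm_apply, Finset.sum_range,
      Finset.sum_congr rfl fun (i : Fin m) _ => hsq (h i) (hh i i.2)]
    simp only [conjTranspose_eq_transpose_of_trivial, Matrix.mul_apply, Matrix.transpose_apply,
      Matrix.of_apply, B, map_sum, map_mul, Finset.sum_mul]
    symm
    conv_lhs => rw [Finset.sum_comm]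
    exact Finset.sum_congr rfl fun a _ => Finset.sum_comm
  refine ⟨(B f)ᴴ * B f, (B g)ᴴ * B g, posSemidef_conjTranspose_mul_self _,
    posSemidef_conjTranspose_mul_self _, Matrix.ext fun u v => ?_⟩
  obtain ⟨⟩ := u
  obtain ⟨⟩ := v
  rw [Matrix.of_apply, pmpForm, Matrix.add_apply, Matrix.smul_apply, smul_eq_mul,
    hGram f fun i hi => (hfg i hi).1, hGram g fun i hi => (hfg i hi).2]
  exact hP

end Converse

end SimmonsDuffin2015

end Literature.Computation.Certificates
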